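import Summits.QuantumFields.BalabanUV.Beta.RelInvCombBorderedKKT

/-!
# `BalabanUV.Beta.RelInvCongruence` — binder row D1, work item K-U3a (re-scoped (Z)_m, R-D1-g24-2): **THE FOUR RELATIVE-INVERSE RULES ARE STABLE
# UNDER CONGRUENCE BY A SLICE-PRESERVING INVERTIBLE CORRECTOR** — if `(A, 𝕄, E)` satisfy `E·A = A = A·E`, `A·𝕄·E = E = E·𝕄·A` and `Ψ`, `Φ` are mutually
# inverse with `E·Ψ·E = Ψ·E`, `E·Φ·E = Φ·E` (both map `range E` into itself), then `(Ψ·A·Ψᵀ, Φᵀ·𝕄·Φ, E)` satisfy the same four rules w.r.t. the SAME `E`;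
# block form for bordered operators: `Φ̂ᵀ·[[K, B],[C, 0]]·Φ̂ = [[ΦᵀKΦ, ΦᵀB],[CΦ, 0]]`, `= [[K, ΦᵀB],[CΦ, 0]]` for a `K`-flat corrector
# (β sub-cell, BINDER-OWNERS row D1 OWNER, lineage an2 gen 24; the matrix-level content of an3-g37's A2-ENGINE-TERMS §1 (ii)–(iii), object (a1*))

HONEST FRAMING (cell charter, verbatim): «discharging BetaPertH makes Balaban's UV stability UNCONDITIONAL — a real
constructive-QFT result; it is NOT the continuum limit and NOT the Clay problem.»
HONEST DEPENDENCY: continuum YM on T⁴ ⇐ BetaPertH ∧ nine spine estimates (0/9 proved); BetaPertH ⇐ (D1) ∧ (D4) ∧ CAP+tail;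
G-an2-4 gates asym, D1 and NE2/3/4.
ABSOLUTE RULE (cell, verbatim): «No internally-minted statement may enter as a cited fact. Every hypothesis is either kernel-proved in this
package or a verbatim quotation of a PUBLISHED theorem with page reference. The manuscript(s) under audit are NOT citable for their own
disputed steps — they are the thing under adjudication; programme-internal (2001/route/tribunal) claims are never citable.»
NOTHING below is cited: no `[cite: …]`, no `def`, no `Prop` fact.  Every declaration is [folklore] linear algebra over a field (Mathlib block matrices;
K-U1 `RelInvCombBorderedKKT` is imported for the currency only).  It asserts nothing about Bałaban's objects.

WHY (row-D1 owner, gen 24; RULING R-D1-g24-2 on an3-g37's `A2-ENGINE-TERMS.v1.md` §1, §4 (5)(β)).  The composite one-shot dressing of record (a1*)_m is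
`G* := Ψ̂·G·Ψ̂ᵀ` with `G = coDressKBmAt ρ_n n (KInv n)` the relative inverse of the STRAIGHT bordered operator `𝕄^str = bhK n` on the comb slice `V_n ⊕ multipliers`
(`RelInvBorderedHessian.relInv_coDressKBmAt_KInv`: the four rules w.r.t. `E = axEc`), `Ψ̂ = diag(Ψ, 1)`, `Ψ = 1 − Gd_f∘Ext_n∘ζ_m` a corrector with `range(Ψ − 1) ⊆ V_n`
(so `Ψ` AND `Ψ⁻¹ = 1 + Gd_f∘Ext_n∘ζ_m` map the slice into itself), and `𝕄^comp = Φ̂ᵀ·𝕄^str·Φ̂`, `Φ = Ψ⁻¹` (an3 §1 (ii): `L·Ψ = Q_n`, `ΨᵀA″Ψ = A″`).  an3 §4 (5)(β)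
re-scoped the owner's item (Z)_m to «the conjugation lemma + coarse-exactness»; THIS FILE is the conjugation lemma, generic and sign-agnostic (it covers
`kkt`'s `+Qᵀ` border and `bhK`'s `−𝒬ᵀ` border alike): the four rules transfer to `(G*, 𝕄^comp, E)` with the SAME projector `E` exactly when the corrector
and its inverse preserve `range E` — no commutation `EΨ = ΨE` is needed (it fails for (a1*): `(Ψ − 1)(1 − E) ≠ 0`).  Coarse-exactness (K-U3b: why
`dΦ^comp_m(𝟙) − contourSum n = Gd_c∘ζ_m`, i.e. why such a `Ψ` exists with `Q_n·Φ = L`) is the OTHER half and is not here.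

WHAT (all [folklore]; `𝕜` a field, `α`, `ν`, `μ` finite index types):
§1 **`rule1_congr`**, **`rule2_congr`**, **`rule3_congr`**, **`rule4_congr`**, **`relInv_congr`** (the four rules for `(Ψ·A·Ψᵀ, Φᵀ·M·Φ, E)` from those of
   `(A, M, E)`, `Ψ·Φ = 1`, `Φ·Ψ = 1`, `Eᵀ = E`, `E·Ψ·E = Ψ·E`, `E·Φ·E = Φ·E`); `range_preserving_transpose` (`E·Ψᵀ·E = E·Ψᵀ`).
§2 GENERAL CONGRUENCE WITHOUT SLICE PRESERVATION: **`rules_congr_oblique`** — the rules always transfer with the OBLIQUE projectors `E_L := Ψ·E·Φ` (left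
   rules) and `E_R := Φᵀ·E·Ψᵀ` (right rules); `E_L = E` iff `E·Ψ = Ψ·E`-type commutation (`oblique_eq_of_commute`).
§3 BORDERED OPERATORS: **`fromBlocks_diag_conj`** (`(fromBlocks Φ 0 0 1)ᵀ·fromBlocks K B C 0·fromBlocks Φ 0 0 1 = fromBlocks (ΦᵀKΦ) (ΦᵀB) (CΦ) 0`),
   **`conj_eq_of_flat`** (`K·(Φ − 1) = 0`, `(Φ − 1)ᵀ·K = 0` ⟹ `ΦᵀKΦ = K`), `fromBlocks_diag_mul_inv` (`diag(Ψ,1)·diag(Φ,1) = 1`), `fromBlocks_diag_transpose`,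
   `blockDiag_preserves` (`E = fromBlocks E_f 0 0 1`, `E_f·Ψ·E_f = Ψ·E_f` ⟹ `E·diag(Ψ,1)·E = diag(Ψ,1)·E`), `blockDiag_transpose_of_symm`, and the headline
   **`relInv_congr_bordered`**: rules for `(G, fromBlocks K B C 0, fromBlocks E_f 0 0 1)` + a `K`-flat slice-preserving corrector pair `(Ψ, Φ)` ⟹ rules for
   `(diag(Ψ,1)·G·diag(Ψ,1)ᵀ, fromBlocks K (ΦᵀB) (CΦ) 0, fromBlocks E_f 0 0 1)` — the (a1*) shape: SAME fine form, border re-linearised to `C·Φ`, SAME slice.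
Provenance: β sub-cell, unit beta-an2 gen 24 (prover-b2b-balaban-beta-an2-g24-0), 2026-08-20; v1.1 (same gen): DOCFIX only (d1-formalise-ref I-d1ref30-1: the
flatness lemma is `conj_eq_of_flat`), declarations byte-identical.  NOT (SDF), NOT D1, NOT `BetaPertH`, NOT continuum, NOT Clay.
-/

namespace Summit.QuantumFields.BalabanUV.Beta.RelInvCongruence

open scoped Matrix
open Matrix

variable {𝕜 : Type*} [Field 𝕜]

/-! ## §1 Congruence by a slice-preserving invertible corrector: the SAME projector -/

section Same

variable {α : Type*} [Fintype α] [DecidableEq α]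
variable {A M E Ψ Φ : Matrix α α 𝕜}

omit [DecidableEq α] in
/-- [folklore] Slice preservation transposes: `Eᵀ = E` and `E·Ψ·E = Ψ·E` give `E·Ψᵀ·E = E·Ψᵀ`. -/
theorem range_preserving_transpose (hE : Eᵀ = E) (hΨ : E * Ψ * E = Ψ * E) : E * Ψᵀ * E = E * Ψᵀ := by
  have h := congrArg Matrix.transpose hΨ
  rw [Matrix.transpose_mul, Matrix.transpose_mul, Matrix.transpose_mul, hE] at h
  -- h : E * (Ψᵀ * E) = E * Ψᵀ
  rw [← Matrix.mul_assoc] at h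
  exact h

omit [DecidableEq α] in
/-- [folklore] **RULE 1 TRANSFERS**: `E·A = A` and `E·Ψ·E = Ψ·E` ⟹ `E·(Ψ·A·Ψᵀ) = Ψ·A·Ψᵀ`. -/
theorem rule1_congr (hEA : E * A = A) (hΨ : E * Ψ * E = Ψ * E) : E * (Ψ * A * Ψᵀ) = Ψ * A * Ψᵀ := by
  calc E * (Ψ * A * Ψᵀ) = E * Ψ * (E * A) * Ψᵀ := by rw [hEA]; simp only [Matrix.mul_assoc]
    _ = (E * Ψ * E) * A * Ψᵀ := by simp only [Matrix.mul_assoc]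
    _ = Ψ * (E * A) * Ψᵀ := by rw [hΨ]; simp only [Matrix.mul_assoc]
    _ = Ψ * A * Ψᵀ := by rw [hEA]

omit [DecidableEq α] in
/-- [folklore] **RULE 2 TRANSFERS**: `A·E = A`, `Eᵀ = E` and `E·Ψ·E = Ψ·E` ⟹ `(Ψ·A·Ψᵀ)·E = Ψ·A·Ψᵀ`. -/
theorem rule2_congr (hAE : A * E = A) (hE : Eᵀ = E) (hΨ : E * Ψ * E = Ψ * E) : Ψ * A * Ψᵀ * E = Ψ * A * Ψᵀ := by
  have hT := range_preserving_transpose hE hΨ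
  calc Ψ * A * Ψᵀ * E = Ψ * (A * E) * Ψᵀ * E := by rw [hAE]
    _ = Ψ * A * (E * Ψᵀ * E) := by simp only [Matrix.mul_assoc]
    _ = Ψ * A * (E * Ψᵀ) := by rw [hT]
    _ = Ψ * (A * E) * Ψᵀ := by simp only [Matrix.mul_assoc]
    _ = Ψ * A * Ψᵀ := by rw [hAE]

/-- [folklore] **RULE 3 TRANSFERS**: `A·M·E = E`, `Ψ·Φ = 1` and `E·Φ·E = Φ·E` ⟹ `(Ψ·A·Ψᵀ)·(Φᵀ·M·Φ)·E = E`. -/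
theorem rule3_congr (hAME : A * M * E = E) (hΨΦ : Ψ * Φ = 1) (hΦ : E * Φ * E = Φ * E) :
    Ψ * A * Ψᵀ * (Φᵀ * M * Φ) * E = E := by
  have hΦΨ : Φ * Ψ = 1 := mul_eq_one_comm.mp hΨΦ
  have hT : Ψᵀ * Φᵀ = 1 := by rw [← Matrix.transpose_mul, hΦΨ, Matrix.transpose_one]
  calc Ψ * A * Ψᵀ * (Φᵀ * M * Φ) * E = Ψ * A * (Ψᵀ * Φᵀ) * M * (Φ * E) := by simp only [Matrix.mul_assoc]
    _ = Ψ * A * M * (E * Φ * E) := by rw [hT, hΦ]; simp only [Matrix.mul_assoc, Matrix.mul_one]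
    _ = Ψ * (A * M * E) * Φ * E := by simp only [Matrix.mul_assoc]
    _ = Ψ * (E * Φ * E) := by rw [hAME]; simp only [Matrix.mul_assoc]
    _ = (Ψ * Φ) * E := by rw [hΦ]; simp only [Matrix.mul_assoc]
    _ = E := by rw [hΨΦ, Matrix.one_mul]

/-- [folklore] **RULE 4 TRANSFERS**: `E·M·A = E`, `Ψ·Φ = 1`, `Eᵀ = E` and `E·Φ·E = Φ·E` ⟹ `E·(Φᵀ·M·Φ)·(Ψ·A·Ψᵀ) = E`. -/
theorem rule4_congr (hEMA : E * M * A = E) (hΨΦ : Ψ * Φ = 1) (hE : Eᵀ = E) (hΦ : E * Φ * E = Φ * E) :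
    E * (Φᵀ * M * Φ) * (Ψ * A * Ψᵀ) = E := by
  have hΦΨ : Φ * Ψ = 1 := mul_eq_one_comm.mp hΨΦ
  have hT := range_preserving_transpose hE hΦ
  have hT' : Φᵀ * Ψᵀ = 1 := by rw [← Matrix.transpose_mul, hΨΦ, Matrix.transpose_one]
  calc E * (Φᵀ * M * Φ) * (Ψ * A * Ψᵀ) = E * Φᵀ * M * (Φ * Ψ) * A * Ψᵀ := by simp only [Matrix.mul_assoc]
    _ = (E * Φᵀ) * M * A * Ψᵀ := by rw [hΦΨ, Matrix.mul_one]
    _ = (E * Φᵀ * E) * M * A * Ψᵀ := by rw [hT]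
    _ = E * Φᵀ * (E * M * A) * Ψᵀ := by simp only [Matrix.mul_assoc]
    _ = E * Φᵀ * E * Ψᵀ := by rw [hEMA]
    _ = E * (Φᵀ * Ψᵀ) := by rw [hT]; simp only [Matrix.mul_assoc]
    _ = E := by rw [hT', Matrix.mul_one]

/-- [folklore] **THE FOUR RULES ARE STABLE UNDER SLICE-PRESERVING CONGRUENCE** (all four at once). -/
theorem relInv_congr (hEA : E * A = A) (hAE : A * E = A) (hAME : A * M * E = E) (hEMA : E * M * A = E)
    (hΨΦ : Ψ * Φ = 1) (hE : Eᵀ = E) (hΨ : E * Ψ * E = Ψ * E) (hΦ : E * Φ * E = Φ * E) :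
    E * (Ψ * A * Ψᵀ) = Ψ * A * Ψᵀ ∧ Ψ * A * Ψᵀ * E = Ψ * A * Ψᵀ ∧
      Ψ * A * Ψᵀ * (Φᵀ * M * Φ) * E = E ∧ E * (Φᵀ * M * Φ) * (Ψ * A * Ψᵀ) = E :=
  ⟨rule1_congr hEA hΨ, rule2_congr hAE hE hΨ, rule3_congr hAME hΨΦ hΦ, rule4_congr hEMA hΨΦ hE hΦ⟩

end Same

/-! ## §2 Without slice preservation: the rules transfer with OBLIQUE projectors -/

section Oblique

variable {α : Type*} [Fintype α] [DecidableEq α]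
variable {A M E Ψ Φ : Matrix α α 𝕜}

/-- [folklore] **GENERAL CONGRUENCE** (no slice hypothesis): with `E_L := Ψ·E·Φ` and `E_R := Φᵀ·E·Ψᵀ`, the left rules transfer w.r.t. `E_L` and the right
rules w.r.t. `E_R`: `E_L·A* = A*`, `A*·E_R = A*`, `A*·M*·E_L = E_L`, `E_R·M*·A* = E_R` (`A* = Ψ·A·Ψᵀ`, `M* = Φᵀ·M·Φ`, `Ψ·Φ = 1`). -/
theorem rules_congr_oblique (hEA : E * A = A) (hAE : A * E = A) (hAME : A * M * E = E) (hEMA : E * M * A = E) (hΨΦ : Ψ * Φ = 1) :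
    (Ψ * E * Φ) * (Ψ * A * Ψᵀ) = Ψ * A * Ψᵀ ∧ Ψ * A * Ψᵀ * (Φᵀ * E * Ψᵀ) = Ψ * A * Ψᵀ ∧
      Ψ * A * Ψᵀ * (Φᵀ * M * Φ) * (Ψ * E * Φ) = Ψ * E * Φ ∧ (Φᵀ * E * Ψᵀ) * (Φᵀ * M * Φ) * (Ψ * A * Ψᵀ) = Φᵀ * E * Ψᵀ := by
  have hΦΨ : Φ * Ψ = 1 := mul_eq_one_comm.mp hΨΦ
  have hT : Ψᵀ * Φᵀ = 1 := by rw [← Matrix.transpose_mul, hΦΨ, Matrix.transpose_one]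
  refine ⟨?_, ?_, ?_, ?_⟩
  · calc Ψ * E * Φ * (Ψ * A * Ψᵀ) = Ψ * E * (Φ * Ψ) * A * Ψᵀ := by simp only [Matrix.mul_assoc]
      _ = Ψ * (E * A) * Ψᵀ := by rw [hΦΨ, Matrix.mul_one]; simp only [Matrix.mul_assoc]
      _ = Ψ * A * Ψᵀ := by rw [hEA]
  · calc Ψ * A * Ψᵀ * (Φᵀ * E * Ψᵀ) = Ψ * A * (Ψᵀ * Φᵀ) * E * Ψᵀ := by simp only [Matrix.mul_assoc]
      _ = Ψ * (A * E) * Ψᵀ := by rw [hT, Matrix.mul_one]; simp only [Matrix.mul_assoc]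
      _ = Ψ * A * Ψᵀ := by rw [hAE]
  · calc Ψ * A * Ψᵀ * (Φᵀ * M * Φ) * (Ψ * E * Φ) = Ψ * A * (Ψᵀ * Φᵀ) * M * (Φ * Ψ) * E * Φ := by simp only [Matrix.mul_assoc]
      _ = Ψ * (A * M * E) * Φ := by rw [hT, hΦΨ, Matrix.mul_one, Matrix.mul_one]; simp only [Matrix.mul_assoc]
      _ = Ψ * E * Φ := by rw [hAME]
  · calc Φᵀ * E * Ψᵀ * (Φᵀ * M * Φ) * (Ψ * A * Ψᵀ) = Φᵀ * E * (Ψᵀ * Φᵀ) * M * (Φ * Ψ) * A * Ψᵀ := by simp only [Matrix.mul_assoc]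
      _ = Φᵀ * (E * M * A) * Ψᵀ := by rw [hT, hΦΨ, Matrix.mul_one, Matrix.mul_one]; simp only [Matrix.mul_assoc]
      _ = Φᵀ * E * Ψᵀ := by rw [hEMA]

/-- [folklore] If the corrector COMMUTES with the projector, the oblique projectors are `E` itself: `E·Ψ = Ψ·E`, `Ψ·Φ = 1` ⟹ `Ψ·E·Φ = E` and
`Φᵀ·E·Ψᵀ = E` (for symmetric `E`).  (For (a1*) this does NOT hold; §1's weaker slice-preservation does.) -/
theorem oblique_eq_of_commute (hc : E * Ψ = Ψ * E) (hΨΦ : Ψ * Φ = 1) (hE : Eᵀ = E) : Ψ * E * Φ = E ∧ Φᵀ * E * Ψᵀ = E := by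
  have h1 : Ψ * E * Φ = E := by rw [← hc, Matrix.mul_assoc, hΨΦ, Matrix.mul_one]
  refine ⟨h1, ?_⟩
  have h2 := congrArg Matrix.transpose h1
  rw [Matrix.transpose_mul, Matrix.transpose_mul, hE, ← Matrix.mul_assoc] at h2
  exact h2

end Oblique

/-! ## §3 Bordered operators: congruence by `diag(Φ, 1)` re-linearises the border and keeps a flat fine form -/

section Bordered

variable {ν μ : Type*} [Fintype ν] [Fintype μ] [DecidableEq ν] [DecidableEq μ]

omit [DecidableEq ν] in
/-- [folklore] **CONGRUENCE OF A BORDERED OPERATOR BY A FIELD-BLOCK CORRECTOR**: `diag(Φ,1)ᵀ·[[K, B],[C, 0]]·diag(Φ,1) = [[ΦᵀKΦ, ΦᵀB],[CΦ, 0]]`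
(sign-agnostic: `B = Cᵀ` is `kkt`, `B = −Cᵀ` is the literal's `bhK`). -/
theorem fromBlocks_diag_conj (K : Matrix ν ν 𝕜) (B : Matrix ν μ 𝕜) (C : Matrix μ ν 𝕜) (Φ : Matrix ν ν 𝕜) :
    (fromBlocks Φ 0 0 (1 : Matrix μ μ 𝕜))ᵀ * fromBlocks K B C 0 * fromBlocks Φ 0 0 (1 : Matrix μ μ 𝕜) =
      fromBlocks (Φᵀ * K * Φ) (Φᵀ * B) (C * Φ) 0 := by
  rw [fromBlocks_transpose, fromBlocks_multiply, fromBlocks_multiply]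
  simp [Matrix.mul_assoc]

omit [DecidableEq μ] [Fintype μ] in
/-- [folklore] **A `K`-FLAT CORRECTOR KEEPS THE FINE FORM**: `K·(Φ − 1) = 0` and `(Φ − 1)ᵀ·K = 0` (the corrector moves only along `K`-null — gauge —
directions) ⟹ `Φᵀ·K·Φ = K`. -/
theorem conj_eq_of_flat {K Φ : Matrix ν ν 𝕜} (h1 : K * (Φ - 1) = 0) (h2 : (Φ - 1)ᵀ * K = 0) : Φᵀ * K * Φ = K := by
  have e1 : K * Φ = K := by
    have := h1; rw [Matrix.mul_sub, Matrix.mul_one, sub_eq_zero] at this; exact this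
  have e2 : Φᵀ * K = K := by
    have := h2; rw [Matrix.transpose_sub, Matrix.transpose_one, Matrix.sub_mul, Matrix.one_mul, sub_eq_zero] at this; exact this
  rw [Matrix.mul_assoc, e1, e2]

/-- [folklore] `diag(Ψ,1)·diag(Φ,1) = 1` when `Ψ·Φ = 1`. -/
theorem fromBlocks_diag_mul_inv {Ψ Φ : Matrix ν ν 𝕜} (h : Ψ * Φ = 1) :
    fromBlocks Ψ 0 0 (1 : Matrix μ μ 𝕜) * fromBlocks Φ 0 0 (1 : Matrix μ μ 𝕜) = 1 := by
  rw [fromBlocks_multiply, ← fromBlocks_one]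
  simp [h]

omit [Fintype ν] [Fintype μ] [DecidableEq ν] in
/-- [folklore] `diag(Ψ,1)ᵀ = diag(Ψᵀ,1)`. -/
theorem fromBlocks_diag_transpose (Ψ : Matrix ν ν 𝕜) :
    (fromBlocks Ψ 0 0 (1 : Matrix μ μ 𝕜))ᵀ = fromBlocks Ψᵀ 0 0 (1 : Matrix μ μ 𝕜) := by
  rw [fromBlocks_transpose]; simp

omit [DecidableEq ν] in
/-- [folklore] A block-diagonal projector `E = diag(E_f, 1)` is preserved by `diag(Ψ, 1)` when `E_f` is preserved by `Ψ`: `E_f·Ψ·E_f = Ψ·E_f` ⟹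
`E·diag(Ψ,1)·E = diag(Ψ,1)·E`. -/
theorem blockDiag_preserves {Ef Ψ : Matrix ν ν 𝕜} (h : Ef * Ψ * Ef = Ψ * Ef) :
    fromBlocks Ef 0 0 (1 : Matrix μ μ 𝕜) * fromBlocks Ψ 0 0 (1 : Matrix μ μ 𝕜) * fromBlocks Ef 0 0 (1 : Matrix μ μ 𝕜) =
      fromBlocks Ψ 0 0 (1 : Matrix μ μ 𝕜) * fromBlocks Ef 0 0 (1 : Matrix μ μ 𝕜) := by
  rw [fromBlocks_multiply, fromBlocks_multiply, fromBlocks_multiply]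
  simp [h]

omit [Fintype ν] [Fintype μ] [DecidableEq ν] in
/-- [folklore] A block-diagonal projector with symmetric field block is symmetric. -/
theorem blockDiag_transpose_of_symm {Ef : Matrix ν ν 𝕜} (h : Efᵀ = Ef) :
    (fromBlocks Ef 0 0 (1 : Matrix μ μ 𝕜))ᵀ = fromBlocks Ef 0 0 (1 : Matrix μ μ 𝕜) := by
  rw [fromBlocks_transpose]; simp [h]

/-- [folklore] **THE (a1*) SHAPE: RELATIVE INVERSE OF THE RE-LINEARISED BORDERED OPERATOR ON THE SAME SLICE.**  Let `G` satisfy the four rules for the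
bordered operator `𝕄 = [[K, B],[C, 0]]` w.r.t. the block-diagonal projector `E = diag(E_f, 1)` (`E_fᵀ = E_f`; the comb-slice coordinate projector on
fields, identity on multipliers), and let `(Ψ, Φ)` be a mutually inverse corrector pair on fields with `E_f·Ψ·E_f = Ψ·E_f`, `E_f·Φ·E_f = Φ·E_f` (both
preserve the slice) and `K·(Φ − 1) = 0`, `(Φ − 1)ᵀ·K = 0` (`K`-flat).  Then `G* := diag(Ψ,1)·G·diag(Ψ,1)ᵀ` satisfies the four rules for the
RE-LINEARISED operator `𝕄* = [[K, ΦᵀB],[C·Φ, 0]]` w.r.t. the SAME `E`. -/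
theorem relInv_congr_bordered {K Ef Ψ Φ : Matrix ν ν 𝕜} {B : Matrix ν μ 𝕜} {C : Matrix μ ν 𝕜} {G : Matrix (ν ⊕ μ) (ν ⊕ μ) 𝕜}
    (hEG : fromBlocks Ef 0 0 (1 : Matrix μ μ 𝕜) * G = G) (hGE : G * fromBlocks Ef 0 0 (1 : Matrix μ μ 𝕜) = G)
    (hGME : G * fromBlocks K B C 0 * fromBlocks Ef 0 0 (1 : Matrix μ μ 𝕜) = fromBlocks Ef 0 0 1)
    (hEMG : fromBlocks Ef 0 0 (1 : Matrix μ μ 𝕜) * fromBlocks K B C 0 * G = fromBlocks Ef 0 0 1)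
    (hEf : Efᵀ = Ef) (hΨΦ : Ψ * Φ = 1) (hΨ : Ef * Ψ * Ef = Ψ * Ef) (hΦ : Ef * Φ * Ef = Φ * Ef)
    (hK1 : K * (Φ - 1) = 0) (hK2 : (Φ - 1)ᵀ * K = 0) :
    fromBlocks Ef 0 0 (1 : Matrix μ μ 𝕜) * (fromBlocks Ψ 0 0 (1 : Matrix μ μ 𝕜) * G * (fromBlocks Ψ 0 0 (1 : Matrix μ μ 𝕜))ᵀ) =
        fromBlocks Ψ 0 0 (1 : Matrix μ μ 𝕜) * G * (fromBlocks Ψ 0 0 (1 : Matrix μ μ 𝕜))ᵀ ∧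
      fromBlocks Ψ 0 0 (1 : Matrix μ μ 𝕜) * G * (fromBlocks Ψ 0 0 (1 : Matrix μ μ 𝕜))ᵀ * fromBlocks Ef 0 0 (1 : Matrix μ μ 𝕜) =
        fromBlocks Ψ 0 0 (1 : Matrix μ μ 𝕜) * G * (fromBlocks Ψ 0 0 (1 : Matrix μ μ 𝕜))ᵀ ∧
      fromBlocks Ψ 0 0 (1 : Matrix μ μ 𝕜) * G * (fromBlocks Ψ 0 0 (1 : Matrix μ μ 𝕜))ᵀ * fromBlocks K (Φᵀ * B) (C * Φ) 0 *
          fromBlocks Ef 0 0 (1 : Matrix μ μ 𝕜) = fromBlocks Ef 0 0 1 ∧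
      fromBlocks Ef 0 0 (1 : Matrix μ μ 𝕜) * fromBlocks K (Φᵀ * B) (C * Φ) 0 *
          (fromBlocks Ψ 0 0 (1 : Matrix μ μ 𝕜) * G * (fromBlocks Ψ 0 0 (1 : Matrix μ μ 𝕜))ᵀ) = fromBlocks Ef 0 0 1 := by
  -- the re-linearised operator is the congruent one, by flatness
  have hM : fromBlocks K (Φᵀ * B) (C * Φ) 0 =
      (fromBlocks Φ 0 0 (1 : Matrix μ μ 𝕜))ᵀ * fromBlocks K B C 0 * fromBlocks Φ 0 0 (1 : Matrix μ μ 𝕜) := by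
    rw [fromBlocks_diag_conj, conj_eq_of_flat hK1 hK2]
  rw [hM]
  exact relInv_congr hEG hGE hGME hEMG (fromBlocks_diag_mul_inv hΨΦ) (blockDiag_transpose_of_symm hEf) (blockDiag_preserves hΨ)
    (blockDiag_preserves hΦ)

end Bordered

end Summit.QuantumFields.BalabanUV.Beta.RelInvCongruence
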